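import Summits.NavierStokesRegularity.NavierStokesRegularity.Theorems.IsotropicBlobPressureProfiles
import Summits.NavierStokesRegularity.NavierStokesRegularity.Theorems.IsotropicBlobSourceProfiles
import HarnessLib

/-!
# IsotropicBlobPressurePoisson — the W2 profile facts in the LEAD's shared currency (`srcProfileₗ`, `C/√s` decay)

Bridge from plate (Φ) (`Theorems/IsotropicBlobPressureProfiles`, ns-s29-p2 g5) to the shared source names of
`Theorems/IsotropicBlobSourceProfiles` (LEAD S-door ns-s30-p1 g4, 2026-08-28T22:41:04Z): the hypotheses of the LEAD's
abstract assembly `isDecayingPressureOf_zonalPressure` VERBATIM —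

* `F₀ = srcPoly0`, `F₂ = srcPoly2`, `F₄ = srcPoly4` (same rational coefficients, `ring`);
* **1-D Poisson at every `s`**: `4 * s * deriv (deriv Phiₗ) s + (4l+6) * deriv Phiₗ s = srcProfileₗ s` (`l = 0, 2, 4`,
  constants `6 / 14 / 22`), also in the `∀ s, 0 ≤ s → …` form;
* **decay** with one constant `C = 16384/61108047`: `|Phi0 s| ≤ C / √s`, `|Phi2 s| * s ≤ C / √s`,
  `|Phi4 s| * s ^ 2 ≤ C / √s` for `1 ≤ s`;
* `ContDiff ℝ 2 Phiₗ` re-exported and the centre data as separate lemmas (`Phi0_zero`, `deriv_Phi0_zero`, `Phi2_zero`,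
  `Phi4_zero`, `deriv_Phi2_zero`, `deriv_Phi4_zero`).
Everything proved; no named facts; `--supports stmt-NavierStokesRegularity-0056 --as helper` (typed by ns-s29-p2 g5).

HONEST FRAME: explicit data of ONE kinematic witness calibrating the S40/S41 clock doors; items 0056 `NoTypeII`,
10661 and NS regularity are NOT proved; nothing here is a route or a summit statement.
-/

noncomputable section

open Set Filter
open scoped Topology

set_option linter.dupNamespace false

namespace Summit.NavierStokesRegularity.NavierStokesRegularity.Theorems.StrainDoors.IsotropicBlob

open Summit.NavierStokesRegularity.NavierStokesRegularity.Theorems.StrainDoors.HarmonicShell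

/-! ## §1 The two spellings of the sources agree -/

/-- `F₀ = srcPoly0`. -/
theorem F0_eq_srcPoly0 (s : ℝ) : F0 s = srcPoly0 s := by
  simp only [F0, poly9, srcPoly0]
  ring

/-- `F₂ = srcPoly2`. -/
theorem F2_eq_srcPoly2 (s : ℝ) : F2 s = srcPoly2 s := by
  simp only [F2, poly9, srcPoly2]
  ring

/-- `F₄ = srcPoly4`. -/
theorem F4_eq_srcPoly4 (s : ℝ) : F4 s = srcPoly4 s := by
  simp only [F4, poly9, srcPoly4]
  ring

/-! ## §2 The 1-D Poisson identities against `srcProfileₗ` -/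

/-- **`4s·Φ₀″ + 6·Φ₀′ = srcProfile0`** at every `s`. -/
theorem poisson_Phi0_src (s : ℝ) : 4 * s * deriv (deriv Phi0) s + 6 * deriv Phi0 s = srcProfile0 s := by
  rw [poisson_Phi0]
  split_ifs with h
  · rw [srcProfile0_of_le h, F0_eq_srcPoly0]
  · rw [srcProfile0_of_ge (le_of_lt (not_le.1 h))]

/-- **`4s·Φ₂″ + 14·Φ₂′ = srcProfile2`** at every `s`. -/
theorem poisson_Phi2_src (s : ℝ) : 4 * s * deriv (deriv Phi2) s + 14 * deriv Phi2 s = srcProfile2 s := by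
  rw [poisson_Phi2]
  split_ifs with h
  · rw [srcProfile2_of_le h, F2_eq_srcPoly2]
  · rw [srcProfile2_of_ge (le_of_lt (not_le.1 h))]

/-- **`4s·Φ₄″ + 22·Φ₄′ = srcProfile4`** at every `s`. -/
theorem poisson_Phi4_src (s : ℝ) : 4 * s * deriv (deriv Phi4) s + 22 * deriv Phi4 s = srcProfile4 s := by
  rw [poisson_Phi4]
  split_ifs with h
  · rw [srcProfile4_of_le h, F4_eq_srcPoly4]
  · rw [srcProfile4_of_ge (le_of_lt (not_le.1 h))]

/-- the `0 ≤ s`-guarded forms with the constants spelled `4*l+6` (the assembly's hypothesis shape). -/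
theorem poisson_Phi_src :
    (∀ s : ℝ, 0 ≤ s → 4 * s * deriv (deriv Phi0) s + (4 * 0 + 6) * deriv Phi0 s = srcProfile0 s) ∧
    (∀ s : ℝ, 0 ≤ s → 4 * s * deriv (deriv Phi2) s + (4 * 2 + 6) * deriv Phi2 s = srcProfile2 s) ∧
    (∀ s : ℝ, 0 ≤ s → 4 * s * deriv (deriv Phi4) s + (4 * 4 + 6) * deriv Phi4 s = srcProfile4 s) := by
  refine ⟨fun s _ => ?_, fun s _ => ?_, fun s _ => ?_⟩
  · rw [← poisson_Phi0_src s]; norm_num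
  · rw [← poisson_Phi2_src s]; norm_num
  · rw [← poisson_Phi4_src s]; norm_num

/-! ## §3 Decay in the `C/√s` currency (`C = c₂ = 16384/61108047`) -/

/-- `C/√s = C·s^{−1/2}` for `0 < s`. -/
theorem div_sqrt_eq_mul_rpow {s : ℝ} (hs : 0 < s) (C : ℝ) : C / Real.sqrt s = C * s ^ (-(1 / 2 : ℝ)) := by
  rw [Real.sqrt_eq_rpow, div_eq_mul_inv, Real.rpow_neg hs.le]

/-- decay of `Φ₀`: it vanishes outside (`|Φ₀ s| ≤ C/√s` trivially) for `1 ≤ s`. -/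
theorem abs_Phi0_le_src {s : ℝ} (hs : 1 ≤ s) : |Phi0 s| ≤ (16384/61108047 : ℝ) / Real.sqrt s := by
  rw [Phi0_of_ge hs, abs_zero]
  positivity

/-- decay of `Φ₂`: `|Φ₂ s|·s = c₂ s^{−3/2} ≤ c₂/√s` for `1 ≤ s`. -/
theorem abs_Phi2_mul_le_src {s : ℝ} (hs : 1 ≤ s) : |Phi2 s| * s ≤ (16384/61108047 : ℝ) / Real.sqrt s := by
  have hs0 : 0 < s := lt_of_lt_of_le one_pos hs
  rw [Phi2_eq_of_ge hs, abs_of_nonneg (by positivity), div_sqrt_eq_mul_rpow hs0, mul_assoc,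
    ← Real.rpow_add_one hs0.ne']
  exact mul_le_mul_of_nonneg_left (Real.rpow_le_rpow_of_exponent_le hs (by norm_num)) (by norm_num)

/-- decay of `Φ₄`: `|Φ₄ s|·s² = c₄ s^{−5/2} ≤ c₂/√s` for `1 ≤ s`. -/
theorem abs_Phi4_mul_sq_le_src {s : ℝ} (hs : 1 ≤ s) : |Phi4 s| * s ^ 2 ≤ (16384/61108047 : ℝ) / Real.sqrt s := by
  have hs0 : 0 < s := lt_of_lt_of_le one_pos hs
  rw [Phi4_eq_of_ge hs, abs_of_nonneg (by positivity), div_sqrt_eq_mul_rpow hs0, mul_assoc,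
    ← Real.rpow_two, ← Real.rpow_add hs0]
  exact mul_le_mul (by norm_num) (Real.rpow_le_rpow_of_exponent_le hs (by norm_num)) (by positivity)
    (by norm_num)

/-- the three decay bounds packaged with one constant. -/
theorem Phi_decay : ∃ C : ℝ, ∀ s : ℝ, 1 ≤ s →
    |Phi0 s| ≤ C / Real.sqrt s ∧ |Phi2 s| * s ≤ C / Real.sqrt s ∧ |Phi4 s| * s ^ 2 ≤ C / Real.sqrt s :=
  ⟨16384/61108047, fun _ hs => ⟨abs_Phi0_le_src hs, abs_Phi2_mul_le_src hs, abs_Phi4_mul_sq_le_src hs⟩⟩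

/-! ## §4 Centre data as separate lemmas -/

/-- `Φ₀(0) = 47/3780`. -/
theorem Phi0_zero : Phi0 0 = 47 / 3780 := Phi_zero.1
/-- `Φ₂(0) = −1/28`. -/
theorem Phi2_zero : Phi2 0 = -1 / 28 := Phi_zero.2.1
/-- `Φ₄(0) = 52/735`. -/
theorem Phi4_zero : Phi4 0 = 52 / 735 := Phi_zero.2.2
/-- `Φ₀′(0) = −1/4`. -/
theorem deriv_Phi0_zero : deriv Phi0 0 = -1 / 4 := deriv_Phi_zero.1
/-- `Φ₂′(0) = 2/7`. -/
theorem deriv_Phi2_zero : deriv Phi2 0 = 2 / 7 := deriv_Phi_zero.2.1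
/-- `Φ₄′(0) = −172/385`. -/
theorem deriv_Phi4_zero : deriv Phi4 0 = -172 / 385 := deriv_Phi_zero.2.2

/-- `∂_zz p(0) = 2·Φ₀′(0) + 4·Φ₂(0) = −9/14` in the assembly's shape. -/
theorem two_mul_deriv_Phi0_zero_add : 2 * deriv Phi0 0 + 4 * Phi2 0 = -(9 / 14) := centre_zz_Phi

end Summit.NavierStokesRegularity.NavierStokesRegularity.Theorems.StrainDoors.IsotropicBlob

end
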